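import Summits.PneNP.PneNP.Theorems.ExpanderLinearGeneratorsResKExpandingCNF
import Summits.PneNP.PneNP.Theorems.ExpanderLinearGeneratorsRandomKCNF
import HarnessLib

/-!
# The `Res(k)` rung for expanding linear systems, XIV: random `k`-CNFs are hard for `Res(k')`

Support file for `stmt-PneNP-11443`. UNCONDITIONAL version of the session-9 calibration
`LinGen.randomKCNF_hard_of_linearGeneratorDepthFregeHard` one level down the ladder: for `k ≥ 10`,
every natural density `Δ ≥ 1` and every `k'` with `1 ≤ k'`, `8k' ≤ 3k`, there is `ε > 0` with

  `Pr_{φ ∼ F_k(n, Δ n)}[every R(k')-refutation of φ has ≥ 2^{n^ε} lines] → 1`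

(`randomKCNF_resK_hard`; `F_k(n,m) = randomKCNF k n m`, i.i.d. uniform `k`-clauses on distinct
variables). With probability `1 - O(1/n)` the clause supports form a `(γ n, 7k/8)`-cover, hence
`(γ n, 3k/4)`-boundary, expander (the tree's Chvátal–Szemerédi / Ben-Sasson–Wigderson first moment
at cover ratio `7k/8`, which needs `k ≥ 10`), and on that event file XIII applies at
`δ = 1/(k'² + k' + 2)`. Unsatisfiability is not needed (satisfiable CNFs have no refutations), so
every density is covered. This is the Segerlind–Buss–Impagliazzo / Alekhnovich theorem for constant
`k'` in the tree's random model.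

[Segerlind–Buss–Impagliazzo 2004, §6 (random CNFs, `k ≤ √(log n / log log n)`);
Alekhnovich 2011, Thm. 1.1; Chvátal–Szemerédi 1988; Ben-Sasson–Wigderson 2001, §6]
-/

namespace Summit.PneNP.PneNP.Theorems.ResKRestriction

open Filter Topology MeasureTheory Finset
open Literature.Computability.Complexity Literature.Computability.MetaComplexity

/-- **Random `k`-CNFs are exponentially hard for `Res(k')` (unconditional).** For `k ≥ 10`, a
natural density `Δ ≥ 1` and `1 ≤ k'`, `8k' ≤ 3k` there is `ε > 0` with
`Pr_{φ ∼ F_k(n, Δ n)}[every R(k')-refutation of φ has ≥ 2^{n^ε} lines] → 1`.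
[Segerlind–Buss–Impagliazzo 2004, §6; Alekhnovich 2011, Thm. 1.1; Chvátal–Szemerédi 1988]
[folklore] -/
theorem randomKCNF_resK_hard (k Δ k' : ℕ) (hk : 10 ≤ k) (hΔ1 : 1 ≤ Δ) (hk'1 : 1 ≤ k')
    (hk' : 8 * k' ≤ 3 * k) :
    ∃ ε : ℝ, 0 < ε ∧ Tendsto (fun n : ℕ => (randomKCNF k n (Δ * n)).toOuterMeasure
      {φ | ∀ π : List (ResKLine ℕ), IsResKRefutation k' φ π →
          (2 : ℝ) ^ ((n : ℝ) ^ ε) ≤ (resKSize π : ℝ)}) atTop (𝓝 1) := by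
  -- the exponent `δ = 1/(k'² + k' + 2)`
  set δ : ℝ := 1 / ((k' : ℝ) ^ 2 + k' + 2) with hδdef
  have hq : (0 : ℝ) < (k' : ℝ) ^ 2 + k' + 2 := by positivity
  have hδ : 0 < δ := by rw [hδdef]; positivity
  have hδk : δ * ((k' : ℝ) ^ 2 + k' + 2) < 2 := by
    rw [hδdef, one_div, inv_mul_cancel₀ hq.ne']; norm_num
  have hδ1 : δ < 1 := by
    rw [hδdef, div_lt_one hq]; nlinarith
  obtain ⟨ε, hε, N₁, hN₁⟩ := expandingCNF_resK_lowerBound k k' δ hk'1 hk' hδ hδk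
  refine ⟨ε, hε, ?_⟩
  -- constants of the cover-expansion count
  have hkr : (10 : ℝ) ≤ k := by exact_mod_cast hk
  set a : ℝ := 7 * k / 8 with ha
  set B : ℝ := Real.exp (1 + a) * Δ * a with hB
  have ha74 : 7 / 4 ≤ a := by rw [ha]; linarith
  have hak : a + 5 / 4 ≤ k := by rw [ha]; linarith
  have hapos : 0 < a := by linarith
  have hBpos : 0 < B := by rw [hB]; positivity
  set c₀ : ℝ := a * (2 * B) ^ 4 with hc₀
  have hc₀pos : 0 < c₀ := by positivity
  set β : ℕ → ℝ := fun n => 32 * a * B ^ 4 / n with hβ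
  have hβ0 : ∀ n, 0 ≤ β n := fun n => by simp only [hβ]; positivity
  have hβlim : Tendsto β atTop (𝓝 0) := tendsto_const_div_atTop_nhds_zero_nat _
  -- the radius eventually exceeds `n^{1-δ}`
  have hrad : ∀ᶠ n : ℕ in atTop, (n : ℝ) ^ (1 - δ) ≤ ⌊(n : ℝ) / c₀⌋₊ := by
    have hT : Tendsto (fun n : ℕ => (n : ℝ) ^ δ) atTop atTop :=
      (tendsto_rpow_atTop hδ).comp tendsto_natCast_atTop_atTop
    filter_upwards [hT.eventually_ge_atTop (2 * c₀), eventually_ge_atTop 1] with n hn hn1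
    have hn0 : (0 : ℝ) ≤ n := Nat.cast_nonneg n
    have hn1' : (1 : ℝ) ≤ n := by exact_mod_cast hn1
    have hnd : 0 < (n : ℝ) ^ δ := by positivity
    have hsplit : (n : ℝ) = (n : ℝ) ^ δ * (n : ℝ) ^ (1 - δ) := by
      rw [← Real.rpow_add_of_nonneg hn0 hδ.le (by linarith)]; norm_num
    -- `n^{1-δ} ≤ n / (2 c₀)`
    have h1 : (n : ℝ) ^ (1 - δ) ≤ n / (2 * c₀) := by
      rw [le_div_iff₀ (by positivity)]
      calc (n : ℝ) ^ (1 - δ) * (2 * c₀) ≤ (n : ℝ) ^ (1 - δ) * (n : ℝ) ^ δ :=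
            mul_le_mul_of_nonneg_left hn (by positivity)
        _ = n := by rw [mul_comm, ← hsplit]
    -- `n / (2 c₀) ≤ ⌊n / c₀⌋`, as `n / c₀ ≥ 2`
    have hnδle : (n : ℝ) ^ δ ≤ n := by
      calc (n : ℝ) ^ δ ≤ (n : ℝ) ^ (1 : ℝ) := Real.rpow_le_rpow_of_exponent_le hn1' hδ1.le
        _ = n := Real.rpow_one _
    have h2 : 2 ≤ (n : ℝ) / c₀ := by
      rw [le_div_iff₀ hc₀pos]; linarith
    have h3 : (n : ℝ) / c₀ - 1 < ⌊(n : ℝ) / c₀⌋₊ := by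
      have := Nat.lt_floor_add_one ((n : ℝ) / c₀); linarith
    have h4 : (n : ℝ) / (2 * c₀) = (n / c₀) / 2 := by field_simp
    rw [h4] at h1
    linarith
  -- the measure bound, eventually
  have hev : ∀ᶠ n : ℕ in atTop, 1 - ENNReal.ofReal (β n) ≤ (randomKCNF k n (Δ * n)).toOuterMeasure
      {φ | ∀ π : List (ResKLine ℕ), IsResKRefutation k' φ π →
          (2 : ℝ) ^ ((n : ℝ) ^ ε) ≤ (resKSize π : ℝ)} := by
    filter_upwards [hrad, eventually_ge_atTop (max N₁ k)] with n hradn hn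
    have hnN : N₁ ≤ n := le_trans (le_max_left _ _) hn
    have hnk : k ≤ n := le_trans (le_max_right _ _) hn
    have hn1 : 1 ≤ n := le_trans (by omega) hnk
    have hn' : (0 : ℝ) < n := by exact_mod_cast hn1
    classical
    have hKc : (kClauses k n).card = n.choose k * 2 ^ k := card_kClauses k n
    have hKne : (kClauses k n).Nonempty := by
      rw [← Finset.card_pos, hKc]
      exact Nat.mul_pos (Nat.choose_pos hnk) (pow_pos two_pos _)
    set N : ℕ := ⌊(n : ℝ) / c₀⌋₊ with hNdef
    have hN : a * N ≤ n / (2 * B) ^ 4 := by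
      have h1 : (N : ℝ) ≤ n / c₀ := Nat.floor_le (by positivity)
      calc a * N ≤ a * (n / c₀) := mul_le_mul_of_nonneg_left h1 hapos.le
        _ = n / (2 * B) ^ 4 := by rw [hc₀]; field_simp
    set m : ℕ := Δ * n with hm
    set bad : Finset (Fin m → ↥(kClauses k n)) :=
      univ.filter fun c => ¬ IsCoverExpander (fun i => clauseScope (c i : Clause ℕ)) N a with hbad
    have hcard : (bad.card : ℝ) ≤ β n * ((((kClauses k n).card ^ m : ℕ)) : ℝ) :=
      LinGen.card_le_of_forall_not_isCoverExpander_gen hΔ1 hn1 hKne ha74 hak hB hN bad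
        fun c hc => (mem_filter.1 hc).2
    -- the glue
    refine randomKCNF_toOuterMeasure_ge hKne (hβ0 n) bad (fun c hc => ?_) hcard
    have hcov : IsCoverExpander (fun i => clauseScope (c i : Clause ℕ)) N a := by
      by_contra h
      exact hc (mem_filter.2 ⟨mem_univ _, h⟩)
    have hbdry : IsBoundaryExpander (fun i => clauseScope (c i : Clause ℕ)) N (3 / 4 * k) := by
      refine IsCoverExpander.isBoundaryExpander (k := k)
        (fun i => (card_clauseScope_of_mem_kClauses (c i).2).le) ?_
      have : ((k : ℝ) + 3 / 4 * k) / 2 = a := by rw [ha]; ring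
      rw [this]
      exact hcov
    have hexp : IsBoundaryExpander (fun i => (((c i : Clause ℕ)).map Prod.fst).toFinset)
        ((n : ℝ) ^ (1 - δ)) (3 / 4 * k) :=
      hbdry.mono hradn
    intro π hπ
    exact hN₁ n hnN m (fun i => (c i : Clause ℕ))
      (fun i => nodup_map_fst_of_mem_kClauses (c i).2)
      (fun i => LinGen.fst_lt_of_mem_kClauses (c i).2) hexp π hπ
  -- squeeze
  have hlow : Tendsto (fun n : ℕ => 1 - ENNReal.ofReal (β n)) atTop (𝓝 1) := by
    have h1 : Tendsto (fun n : ℕ => ENNReal.ofReal (β n)) atTop (𝓝 0) := by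
      rw [← ENNReal.ofReal_zero]
      exact ENNReal.tendsto_ofReal hβlim
    have h2 := ENNReal.Tendsto.sub (tendsto_const_nhds (x := (1 : ENNReal))) h1
      (Or.inl ENNReal.one_ne_top)
    simpa using h2
  exact tendsto_of_tendsto_of_tendsto_of_le_of_le' hlow tendsto_const_nhds hev
    (Eventually.of_forall fun n => (measure_mono (Set.subset_univ _)).trans
      ((PMF.toOuterMeasure_apply_eq_one_iff _ _).2 (Set.subset_univ _)).le)

/-- **The same in the shape of Feige's crux** (`FeigeRandom3cnfHardForDepthDFrege`,
stmt-PneNP-0298, one system down): for `k ≥ 10`, `Δ ≥ 1`, `1 ≤ k'`, `8k' ≤ 3k` and every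
polynomial `p`, `Pr_{φ ∼ F_k(n, Δ n)}[∃ R(k')-refutation of φ with ≤ p(n) lines] → 0`.
[Segerlind–Buss–Impagliazzo 2004, §6; Alekhnovich 2011, Thm. 1.1] [folklore] -/
theorem randomKCNF_noShortResKRefutations (k Δ k' : ℕ) (hk : 10 ≤ k) (hΔ1 : 1 ≤ Δ)
    (hk'1 : 1 ≤ k') (hk' : 8 * k' ≤ 3 * k) (p : Polynomial ℕ) :
    Tendsto (fun n : ℕ => (randomKCNF k n (Δ * n)).toOuterMeasure
      {φ | ∃ π : List (ResKLine ℕ), IsResKRefutation k' φ π ∧ resKSize π ≤ p.eval n})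
      atTop (𝓝 0) := by
  obtain ⟨ε, hε, hT⟩ := randomKCNF_resK_hard k Δ k' hk hΔ1 hk'1 hk'
  -- eventually `p(n) < 2^{n^ε}`
  obtain ⟨c, e, hce⟩ := Literature.Computability.Complexity.exists_eval_le_mul_pow_add p
  have hev : ∀ᶠ n : ℕ in atTop, ((p.eval n : ℕ) : ℝ) < (2 : ℝ) ^ ((n : ℝ) ^ ε) := by
    have h1 := Literature.Computability.Complexity.eventually_pow_lt_two_rpow_rpow (e + 1) hε
    filter_upwards [h1, eventually_ge_atTop (2 * c + 1)] with n hn hnc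
    have hn1 : (2 * c + 1 : ℝ) ≤ n := by exact_mod_cast hnc
    have hc0 : (0 : ℝ) ≤ c := Nat.cast_nonneg c
    have hne : (1 : ℝ) ≤ (n : ℝ) ^ e := one_le_pow₀ (by linarith)
    have h2 : ((p.eval n : ℕ) : ℝ) ≤ c * (n : ℝ) ^ e + c := by exact_mod_cast hce n
    have h3 : (c : ℝ) * (n : ℝ) ^ e + c ≤ (n : ℝ) ^ (e + 1) := by
      rw [pow_succ]
      nlinarith
    have h5 : ((n : ℝ) ^ (e + 1) : ℝ) < (2 : ℝ) ^ ((n : ℝ) ^ ε) := by simpa using hn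
    linarith
  -- complements under the outer measure of a `PMF`
  have hcompl : ∀ (q : PMF (CNF ℕ)) (s : Set (CNF ℕ)),
      q.toOuterMeasure sᶜ = 1 - q.toOuterMeasure s := by
    intro q s
    have hadd : q.toOuterMeasure s + q.toOuterMeasure sᶜ = 1 := by
      rw [PMF.toOuterMeasure_apply, PMF.toOuterMeasure_apply, ← ENNReal.tsum_add, ← q.tsum_coe]
      refine tsum_congr fun x => ?_
      by_cases hx : x ∈ s
      · rw [Set.indicator_of_mem hx, Set.indicator_of_notMem (show x ∉ sᶜ from fun h => h hx),
          add_zero]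
      · rw [Set.indicator_of_notMem hx, Set.indicator_of_mem (show x ∈ sᶜ from hx), zero_add]
    have hle : q.toOuterMeasure s ≤ 1 := le_of_le_of_eq le_self_add hadd
    rw [add_comm] at hadd
    exact ENNReal.eq_sub_of_add_eq (hle.trans_lt ENNReal.one_lt_top).ne hadd
  -- the short-refutation event sits in the complement of the high-probability event
  have hle : ∀ᶠ n : ℕ in atTop, (randomKCNF k n (Δ * n)).toOuterMeasure
      {φ | ∃ π : List (ResKLine ℕ), IsResKRefutation k' φ π ∧ resKSize π ≤ p.eval n} ≤
      1 - (randomKCNF k n (Δ * n)).toOuterMeasure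
        {φ | ∀ π : List (ResKLine ℕ), IsResKRefutation k' φ π →
          (2 : ℝ) ^ ((n : ℝ) ^ ε) ≤ (resKSize π : ℝ)} := by
    filter_upwards [hev] with n hn
    rw [← hcompl]
    refine measure_mono fun φ hφ hE => ?_
    obtain ⟨π, hπ, hsz⟩ := hφ
    have h1 := hE π hπ
    have h2 : (resKSize π : ℝ) ≤ ((p.eval n : ℕ) : ℝ) := by exact_mod_cast hsz
    linarith
  have hlim : Tendsto (fun n : ℕ => 1 - (randomKCNF k n (Δ * n)).toOuterMeasure
      {φ | ∀ π : List (ResKLine ℕ), IsResKRefutation k' φ π →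
        (2 : ℝ) ^ ((n : ℝ) ^ ε) ≤ (resKSize π : ℝ)}) atTop (𝓝 0) := by
    have h := ENNReal.Tendsto.sub (tendsto_const_nhds (x := (1 : ENNReal))) hT
      (Or.inl ENNReal.one_ne_top)
    simpa using h
  exact tendsto_of_tendsto_of_tendsto_of_le_of_le' tendsto_const_nhds hlim
    (Eventually.of_forall fun n => bot_le) hle

end Summit.PneNP.PneNP.Theorems.ResKRestriction
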